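import Summits.AtomisticToContinuum.Crystallization.Theses.PricedLinkCensus
import Summits.AtomisticToContinuum.Crystallization.Theorems.PricedLinkCensusTruncatedCensusGapNearOfLocalPricing

/-!
# `TruncatedCensusGap`: the split-ready glue of the line `elastic-basin-split`

Route `PricedLinkCensus`, crux `TruncatedCensusGap` (stmt-AtomisticToContinuum-14230), line
`elastic-basin-split` (`Cruxes/TruncatedCensusGap/Lines/elastic_basin_split.lean`; requested by crux
strategist s3 — evidence `PricedLinkCensusTruncatedCensusGapElasticBasinSplit.lean`, p168088, bounced only
on `supports.stub-mismatch` — and registered as four named sub-goals by lead c6, reshape r1).  This file is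
the line's SPLIT-READY GLUE as importable theorems, every statement with the line's Props INLINED:

* `chargedNearSiteDeviates_of` — **THRESH ⇐ T1 ∧ T2**: the threshold lever (a near₂ site charged at
  tolerance `1/100` has, within `5a₀/2`, a reference point whose strained bond lengths are split by more
  than the ratio `2007/2000`, or an atom at distance `≥ a₀/5000` from every reference point) follows from
  the strained link dictionary T1 (`0.8793`-separation, near `⟺ dist = 1 ⟹ ≤ 1.0747`, twelve near points,
  four common near points of `F '' barlowStacking 1 √(2/3) s` under `‖F - a₀‖ ≤ a₀/10`, `a₀ = 977/1000`)
  and the ratio germ engine T2 (abstract charge-freeness in ratio form): negate, pull back by the rigid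
  motion `g` (`dist (g (F z)) (g (F w)) = ‖F (z - w)‖`) and take `T := (g ∘ F) '' barlowStacking 1 √(2/3) s`.
* `ebs_nearChargePricingF_of_localNearPricing2` — **NEAR₂′ ⇐ LNP₂**: the landed `near_pricing_assembly`
  (p169781) with `P :=` the near₂ predicate (only its separation clause, scale `a₀`, is used),
  `Ch := ¬ IsChargeFree (1/100) y`, `e_χ* ≤ 0` (`iInf_energyPerParticle_truncLJ_nonpos`); constant
  `C' = (κ + 37 + max C 0)(400 max ρ 0 / 93 + 1)³ + max C 0 + 205`.
* `ebs_nearChargePricing_of_finsetForm` — **NEAR₂ ⇐ NEAR₂′**: instantiate the `Finset` with the filter of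
  the near₂ predicate (allowance `max C 0`).
* `truncatedCensusGap_of_elasticBasinSplit` — **crux ⇐ FAR₂ ∧ NEAR₂**: a charged site is
  charged-and-near₂ or far₂, so `#charged ≤ #(charged ∧ near₂) + #far₂`; with `κ₂ #far₂ ≤ E − N e*` (FAR₂)
  and `κ₁ #(charged ∧ near₂) ≤ E − N e* + C #far₂` (NEAR₂) the crux holds with
  `κ := κ₁κ₂/(κ₁ + κ₂ + max C 0)` (margin ledger: `κ₁κ₂ #charged ≤ (κ₁ + κ₂ + max C 0)(E − N e*)`, the sum
  of `κ₂ ×` NEAR₂, `κ₁ ×` FAR₂ and `max C 0 ×` FAR₂; no numerical slack is spent).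
* `truncatedCensusGap_of_defectFar_of_localNearPricing2` — **crux ⇐ FAR₂ ∧ LNP₂**: the crux modulo the
  line's two open cores (defect far-site gap; chart-free local near₂ pricing), the bookkeeping in between
  being the three theorems above.
* `nearChargePricing_of_truncatedCensusGap` — **NEAR₂ ⇐ crux** (calibration: NEAR₂ is a genuine piece of
  the crux; allowance `C = 0`, a charged-and-near₂ site is charged).

`V_χ(r) = min 1 (max 0 (4 - 2r)) · V_LJ(r)`, `E = interactionEnergy V_χ y`, `e* = e_χ*` the infimum of the
periodic energies per particle; all statements keep `Function.Injective y` (disproof ledger of the crux: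
`truncatedCensusGap_false_without_injective`) and use `e_χ*` only upward.
-/

noncomputable section

namespace Summit.AtomisticToContinuum.Crystallization.Theorems.PricedLinkCensusTruncatedCensusGap

open scoped BigOperators Classical
open Literature.MathematicalPhysics.StatisticalMechanics Literature.Geometry.DiscreteGeometry
open Summit.AtomisticToContinuum.Crystallization.Theses.PricedLinkCensus (TruncatedCensusGap)

/-! ## THRESH from the strained link dictionary and the ratio germ engine -/

/-- **THRESH ⇐ T1 ∧ T2** (registered sub-goal `chargedNearSiteDeviates_of` of the line
`elastic-basin-split`).  If the strained ideal stackings `F '' barlowStacking 1 √(2/3) s`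
(`‖F v - a₀ v‖ ≤ (a₀/10)‖v‖`, `a₀ = 977/1000`) have the link dictionary T1 and the ratio germ engine
T2 holds, then a near₂ site `i` (closed `3a₀`-patch `a₀/2`-separated and two-way `a₀/8`-matched to
`g (F (barlowStacking 1 √(2/3) s))`) that is charged at tolerance `1/100` has, within `5a₀/2 = 4885/2000`,
a reference point with two unit bonds whose strained lengths are split by more than `2007/2000`, or an
atom at distance `≥ a₀/5000 = 977/5000000` from every reference point.  Proof: negate both
alternatives, set `T := (g ∘ F) '' barlowStacking 1 √(2/3) s`; `dist (g (F z)) (g (F w)) = ‖F (z - w)‖`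
makes `g ∘ F` injective on the stacking (T1 separation) and transports the four clauses of T1 and the
negated ratio clause to `T`, so T2 gives charge-freeness, a contradiction. [folklore] -/
theorem chargedNearSiteDeviates_of : (∀ (s : ℤ → ℤ) (F : EuclideanSpace ℝ (Fin 3) →L[ℝ] EuclideanSpace ℝ (Fin 3)), Literature.MathematicalPhysics.StatisticalMechanics.IsHaggSeq s → (∀ v : EuclideanSpace ℝ (Fin 3), ‖F v - (977 / 1000 : ℝ) • v‖ ≤ 977 / 10000 * ‖v‖) → ∀ z₀ ∈ Literature.MathematicalPhysics.StatisticalMechanics.barlowStacking 1 (Real.sqrt (2 / 3)) s, (∀ z ∈ Literature.MathematicalPhysics.StatisticalMechanics.barlowStacking 1 (Real.sqrt (2 / 3)) s, z ≠ z₀ → (8793 / 10000 : ℝ) ≤ ‖F (z - z₀)‖) ∧ (∀ z ∈ Literature.MathematicalPhysics.StatisticalMechanics.barlowStacking 1 (Real.sqrt (2 / 3)) s, z ≠ z₀ → ‖F (z - z₀)‖ < 1231 / 1000 → dist z z₀ = 1 ∧ ‖F (z - z₀)‖ ≤ 10747 / 10000) ∧ {z ∈ Literature.MathematicalPhysics.StatisticalMechanics.barlowStacking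 1 (Real.sqrt (2 / 3)) s | z ≠ z₀ ∧ ‖F (z - z₀)‖ < 1231 / 1000}.ncard = 12 ∧ (∀ z ∈ Literature.MathematicalPhysics.StatisticalMechanics.barlowStacking 1 (Real.sqrt (2 / 3)) s, z ≠ z₀ → ‖F (z - z₀)‖ < 1231 / 1000 → {w ∈ Literature.MathematicalPhysics.StatisticalMechanics.barlowStacking 1 (Real.sqrt (2 / 3)) s | w ≠ z₀ ∧ w ≠ z ∧ ‖F (w - z₀)‖ < 1231 / 1000 ∧ ‖F (w - z)‖ < 1231 / 1000}.ncard = 4)) → (∀ (N : ℕ) (y : Fin N → EuclideanSpace ℝ (Fin 3)) (i : Fin N) (T : Set (EuclideanSpace ℝ (Fin 3))), (∀ z ∈ T, ∀ w ∈ T, z ≠ w → (8793 / 10000 : ℝ) ≤ dist z w) → (∀ z₀ ∈ T, ∀ z ∈ T, z ≠ z₀ → dist z z₀ < 1231 / 1000 → dist z z₀ ≤ 10747 / 10000) → (∀ z₀ ∈ T, {z ∈ T | z ≠ z₀ ∧ dist z z₀ < 1231 / 1000}.ncard = 12) → (∀ z₀ ∈ T, ∀ z ∈ T, z ≠ z₀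 → dist z z₀ < 1231 / 1000 → {w ∈ T | w ≠ z₀ ∧ w ≠ z ∧ dist w z₀ < 1231 / 1000 ∧ dist w z < 1231 / 1000}.ncard = 4) → (∀ z₀ ∈ T, dist z₀ (y i) ≤ 4885 / 2000 → ∀ z ∈ T, ∀ z' ∈ T, z ≠ z₀ → z' ≠ z₀ → dist z z₀ < 1231 / 1000 → dist z' z₀ < 1231 / 1000 → dist z z₀ ≤ 2007 / 2000 * dist z' z₀) → (∀ j k : Fin N, j ≠ k → dist (y j) (y i) ≤ 2931 / 1000 → 977 / 2000 ≤ dist (y j) (y k)) → (∀ z ∈ T, dist z (y i) ≤ 2931 / 1000 → ∃ j : Fin N, dist (y j) z ≤ 977 / 8000) → (∀ j : Fin N, dist (y j) (y i) ≤ 4885 / 2000 → ∃ z ∈ T, dist (y j) z < 977 / 5000000) → Literature.Geometry.DiscreteGeometry.IsChargeFree (1 / 100 : ℝ) y i) → (∀ (N : ℕ) (y : Fin N → EuclideanSpace ℝ (Fin 3)), Function.Injective y → ∀ (i : Fin N) (s : ℤ → ℤ) (F : EuclideanSpace ℝ (Fin 3) →L[ℝ] EuclideanSpace ℝ (Fin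 3)) (g : EuclideanSpace ℝ (Fin 3) ≃ᵃⁱ[ℝ] EuclideanSpace ℝ (Fin 3)), Literature.MathematicalPhysics.StatisticalMechanics.IsHaggSeq s → (∀ v : EuclideanSpace ℝ (Fin 3), ‖F v - (977 / 1000 : ℝ) • v‖ ≤ 977 / 10000 * ‖v‖) → (∀ j k : Fin N, j ≠ k → dist (y j) (y i) ≤ 2931 / 1000 → 977 / 2000 ≤ dist (y j) (y k)) → (∀ j : Fin N, dist (y j) (y i) ≤ 2931 / 1000 → ∃ z ∈ Literature.MathematicalPhysics.StatisticalMechanics.barlowStacking 1 (Real.sqrt (2 / 3)) s, dist (y j) (g (F z)) ≤ 977 / 8000) → (∀ z ∈ Literature.MathematicalPhysics.StatisticalMechanics.barlowStacking 1 (Real.sqrt (2 / 3)) s, dist (g (F z)) (y i) ≤ 2931 / 1000 → ∃ j : Fin N, dist (y j) (g (F z)) ≤ 977 / 8000) → ¬ Literature.Geometry.DiscreteGeometry.IsChargeFree (1 / 100 : ℝ) y i → (∃ z₀ ∈ Literature.MathematicalPhysics.StatisticalMechanics.barlowStacking 1 (Real.sqrt (2 / 3)) s, ∃ z ∈ Literature.MathematicalPhysics.StatisticalMechanics.barlowStacking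 1 (Real.sqrt (2 / 3)) s, ∃ z' ∈ Literature.MathematicalPhysics.StatisticalMechanics.barlowStacking 1 (Real.sqrt (2 / 3)) s, dist (g (F z₀)) (y i) ≤ 4885 / 2000 ∧ dist z z₀ = 1 ∧ dist z' z₀ = 1 ∧ (2007 / 2000 : ℝ) * ‖F (z' - z₀)‖ < ‖F (z - z₀)‖) ∨ (∃ j : Fin N, dist (y j) (y i) ≤ 4885 / 2000 ∧ ∀ z ∈ Literature.MathematicalPhysics.StatisticalMechanics.barlowStacking 1 (Real.sqrt (2 / 3)) s, (977 / 5000000 : ℝ) ≤ dist (y j) (g (F z)))) := by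
  intro h1 h2 N y _hy i s F g hs hF hsep _hM1 hM2 hch
  by_contra hcon
  have hA : ∀ z₀ ∈ barlowStacking 1 (Real.sqrt (2 / 3)) s, ∀ z ∈ barlowStacking 1 (Real.sqrt (2 / 3)) s,
      ∀ z' ∈ barlowStacking 1 (Real.sqrt (2 / 3)) s, dist (g (F z₀)) (y i) ≤ 4885 / 2000 →
      dist z z₀ = 1 → dist z' z₀ = 1 → ‖F (z - z₀)‖ ≤ 2007 / 2000 * ‖F (z' - z₀)‖ := by
    intro z₀ hz₀ z hz z' hz' hd h1z h1z'
    by_contra hlt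
    push Not at hlt
    exact hcon (Or.inl ⟨z₀, hz₀, z, hz, z', hz', hd, h1z, h1z', hlt⟩)
  have hB : ∀ j : Fin N, dist (y j) (y i) ≤ 4885 / 2000 →
      ∃ z ∈ barlowStacking 1 (Real.sqrt (2 / 3)) s, dist (y j) (g (F z)) < 977 / 5000000 := by
    intro j hj
    by_contra hno
    push Not at hno
    exact hcon (Or.inr ⟨j, hj, hno⟩)
  apply hch
  -- distances in the strained reference
  have hΦd : ∀ z w : EuclideanSpace ℝ (Fin 3), dist (g (F z)) (g (F w)) = ‖F (z - w)‖ := by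
    intro z w
    rw [g.dist_map, dist_eq_norm, map_sub]
  have hD := h1 s F hs hF
  set S := barlowStacking 1 (Real.sqrt (2 / 3)) s with hSdef
  -- injectivity of the reference map on `S`
  have hinj : Set.InjOn (fun z => g (F z)) S := by
    intro z hz w hw heq
    have heq' : g (F z) = g (F w) := heq
    by_contra hne
    have h := (hD w hw).1 z hz hne
    have h0 : ‖F (z - w)‖ = 0 := by rw [← hΦd, heq', dist_self]
    linarith
  refine h2 N y i ((fun z => g (F z)) '' S) ?_ ?_ ?_ ?_ ?_ hsep ?_ ?_
  · rintro _ ⟨z, hz, rfl⟩ _ ⟨w, hw, rfl⟩ hne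
    have hzw : z ≠ w := fun h => hne (by rw [h])
    rw [hΦd]
    exact (hD w hw).1 z hz hzw
  · rintro _ ⟨z₀, hz₀, rfl⟩ _ ⟨z, hz, rfl⟩ hne hd
    have hzne : z ≠ z₀ := fun h => hne (by rw [h])
    rw [hΦd] at hd ⊢
    exact ((hD z₀ hz₀).2.1 z hz hzne hd).2
  · rintro _ ⟨z₀, hz₀, rfl⟩
    have hset : {x ∈ (fun z => g (F z)) '' S | x ≠ g (F z₀) ∧ dist x (g (F z₀)) < 1231 / 1000} =
        (fun z => g (F z)) '' {z ∈ S | z ≠ z₀ ∧ ‖F (z - z₀)‖ < 1231 / 1000} := by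
      ext x
      constructor
      · rintro ⟨⟨z, hz, rfl⟩, hne, hd⟩
        exact ⟨z, ⟨hz, fun h => hne (by rw [h]), by rwa [hΦd] at hd⟩, rfl⟩
      · rintro ⟨z, ⟨hz, hne, hd⟩, rfl⟩
        refine ⟨⟨z, hz, rfl⟩, fun heq => hne (hinj hz hz₀ heq), ?_⟩
        show dist (g (F z)) (g (F z₀)) < 1231 / 1000
        rwa [hΦd]
    rw [hset, (hinj.mono fun z hz => hz.1).ncard_image]
    exact (hD z₀ hz₀).2.2.1
  · rintro _ ⟨z₀, hz₀, rfl⟩ _ ⟨z, hz, rfl⟩ hne hd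
    have hzne : z ≠ z₀ := fun h => hne (by rw [h])
    rw [hΦd] at hd
    have hset : {x ∈ (fun z => g (F z)) '' S | x ≠ g (F z₀) ∧ x ≠ g (F z) ∧
        dist x (g (F z₀)) < 1231 / 1000 ∧ dist x (g (F z)) < 1231 / 1000} =
        (fun z => g (F z)) '' {w ∈ S | w ≠ z₀ ∧ w ≠ z ∧ ‖F (w - z₀)‖ < 1231 / 1000 ∧
          ‖F (w - z)‖ < 1231 / 1000} := by
      ext x
      constructor
      · rintro ⟨⟨w, hw, rfl⟩, hne₀, hne₁, hd₀, hd₁⟩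
        exact ⟨w, ⟨hw, fun h => hne₀ (by rw [h]), fun h => hne₁ (by rw [h]), by rwa [hΦd] at hd₀,
          by rwa [hΦd] at hd₁⟩, rfl⟩
      · rintro ⟨w, ⟨hw, hne₀, hne₁, hd₀, hd₁⟩, rfl⟩
        refine ⟨⟨w, hw, rfl⟩, fun heq => hne₀ (hinj hw hz₀ heq), fun heq => hne₁ (hinj hw hz heq),
          ?_, ?_⟩
        · show dist (g (F w)) (g (F z₀)) < 1231 / 1000
          rwa [hΦd]
        · show dist (g (F w)) (g (F z)) < 1231 / 1000
          rwa [hΦd]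
    rw [hset, (hinj.mono fun w hw => hw.1).ncard_image]
    exact (hD z₀ hz₀).2.2.2 z hz hzne hd
  · rintro _ ⟨z₀, hz₀, rfl⟩ hd _ ⟨z, hz, rfl⟩ _ ⟨z', hz', rfl⟩ hne hne' hdz hdz'
    have hzne : z ≠ z₀ := fun h => hne (by rw [h])
    have hzne' : z' ≠ z₀ := fun h => hne' (by rw [h])
    rw [hΦd] at hdz hdz' ⊢
    rw [hΦd]
    exact hA z₀ hz₀ z hz z' hz' hd ((hD z₀ hz₀).2.1 z hz hzne hdz).1
      ((hD z₀ hz₀).2.1 z' hz' hzne' hdz').1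
  · rintro _ ⟨z, hz, rfl⟩ hd
    exact hM2 z hz hd
  · intro j hj
    obtain ⟨z, hz, hd⟩ := hB j hj
    exact ⟨g (F z), ⟨z, hz, rfl⟩, hd⟩

/-! ## NEAR₂ from the local near₂ pricing LNP₂ -/

/-- **NEAR₂′ ⇐ LNP₂** (bookkeeping of the line `elastic-basin-split`).  Zero-sum transfers `Φ`,
`|Φ| ≤ C`, pricing every deep-near₂ site (all sites within `ρ` are near₂) at `e_χ* ≤ e_i/2 + Φ_i`, and
at `e_χ* + κ` when charged, give for every injective `y` and every finset `S` cut out by the near₂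
predicate `N e_χ* + κ #{charged ∧ i ∈ S} ≤ E + C' #(univ \ S)` with
`C' = (κ + 37 + max C 0)(400 max ρ 0 / 93 + 1)³ + max C 0 + 205`: the landed `near_pricing_assembly`
with `P :=` the near₂ predicate — only its separation clause is used, at the scale `a₀ = 977/1000 ≥ 93/100`
(`3a₀ = 2931/1000`, `a₀/2 = 977/2000`) — `Ch := ¬ IsChargeFree (1/100) y` and `e_χ* ≤ 0`
(`iInf_energyPerParticle_truncLJ_nonpos`). [folklore] -/
theorem ebs_nearChargePricingF_of_localNearPricing2 : (∃ κ C ρ : ℝ, 0 < κ ∧ ∃ Φ : (N : ℕ) → (Fin N → EuclideanSpace ℝ (Fin 3)) → Fin N → ℝ, (∀ (N : ℕ) (y : Fin N → EuclideanSpace ℝ (Fin 3)), Function.Injective y → ∑ i, Φ N y i = 0) ∧ (∀ (N : ℕ) (y : Fin N → EuclideanSpace ℝ (Fin 3)) (i : Fin N), Function.Injective y → |Φ N y i| ≤ C) ∧ ∀ (N : ℕ) (y : Fin N → EuclideanSpace ℝ (Fin 3)) (i : Fin N), Function.Injective y → (∀ i' : Fin N, dist (y i') (y i) ≤ ρ →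 ∃ (s : ℤ → ℤ) (F : EuclideanSpace ℝ (Fin 3) →L[ℝ] EuclideanSpace ℝ (Fin 3)) (g : EuclideanSpace ℝ (Fin 3) ≃ᵃⁱ[ℝ] EuclideanSpace ℝ (Fin 3)), Literature.MathematicalPhysics.StatisticalMechanics.IsHaggSeq s ∧ (∀ v : EuclideanSpace ℝ (Fin 3), ‖F v - (977 / 1000 : ℝ) • v‖ ≤ 977 / 10000 * ‖v‖) ∧ (∀ j k : Fin N, j ≠ k → dist (y j) (y i') ≤ 2931 / 1000 → 977 / 2000 ≤ dist (y j) (y k)) ∧ (∀ j : Fin N, dist (y j) (y i') ≤ 2931 / 1000 → ∃ z ∈ Literature.MathematicalPhysics.StatisticalMechanics.barlowStacking 1 (Real.sqrt (2 / 3)) s, dist (y j) (g (F z)) ≤ 977 / 8000) ∧ (∀ z ∈ Literature.MathematicalPhysics.StatisticalMechanics.barlowStacking 1 (Real.sqrt (2 / 3)) s, dist (g (F z)) (y i') ≤ 2931 / 1000 → ∃ j : Fin N, dist (y j) (g (F z)) ≤ 977 / 8000)) → (⨅ Q : Literature.MathematicalPhysics.StatisticalMechanics.PeriodicConfiguration 3,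 Q.energyPerParticle (fun r => min 1 (max 0 (4 - 2 * r)) * Literature.MathematicalPhysics.StatisticalMechanics.lennardJones r)) ≤ Literature.MathematicalPhysics.StatisticalMechanics.siteEnergy (fun r => min 1 (max 0 (4 - 2 * r)) * Literature.MathematicalPhysics.StatisticalMechanics.lennardJones r) y i / 2 + Φ N y i ∧ (¬ Literature.Geometry.DiscreteGeometry.IsChargeFree (1 / 100 : ℝ) y i → (⨅ Q : Literature.MathematicalPhysics.StatisticalMechanics.PeriodicConfiguration 3, Q.energyPerParticle (fun r => min 1 (max 0 (4 - 2 * r)) * Literature.MathematicalPhysics.StatisticalMechanics.lennardJones r)) + κ ≤ Literature.MathematicalPhysics.StatisticalMechanics.siteEnergy (fun r => min 1 (max 0 (4 - 2 * r)) * Literature.MathematicalPhysics.StatisticalMechanics.lennardJones r) y i / 2 + Φ N y i)) → (∃ κ C : ℝ, 0 < κ ∧ ∀ (N : ℕ) (y : Fin N → EuclideanSpace ℝ (Fin 3)), Function.Injective y → ∀ S : Finset (Fin N), (∀ i : Fin N, i ∈ S ↔ ∃ (s : ℤ → ℤ) (F : EuclideanSpace ℝ (Fin 3) →L[ℝ]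 EuclideanSpace ℝ (Fin 3)) (g : EuclideanSpace ℝ (Fin 3) ≃ᵃⁱ[ℝ] EuclideanSpace ℝ (Fin 3)), Literature.MathematicalPhysics.StatisticalMechanics.IsHaggSeq s ∧ (∀ v : EuclideanSpace ℝ (Fin 3), ‖F v - (977 / 1000 : ℝ) • v‖ ≤ 977 / 10000 * ‖v‖) ∧ (∀ j k : Fin N, j ≠ k → dist (y j) (y i) ≤ 2931 / 1000 → 977 / 2000 ≤ dist (y j) (y k)) ∧ (∀ j : Fin N, dist (y j) (y i) ≤ 2931 / 1000 → ∃ z ∈ Literature.MathematicalPhysics.StatisticalMechanics.barlowStacking 1 (Real.sqrt (2 / 3)) s, dist (y j) (g (F z)) ≤ 977 / 8000) ∧ (∀ z ∈ Literature.MathematicalPhysics.StatisticalMechanics.barlowStacking 1 (Real.sqrt (2 / 3)) s, dist (g (F z)) (y i) ≤ 2931 / 1000 → ∃ j : Fin N, dist (y j) (g (F z)) ≤ 977 / 8000)) → (N : ℝ) * (⨅ Q : Literature.MathematicalPhysics.StatisticalMechanics.PeriodicConfiguration 3, Q.energyPerParticle (fun r => min 1 (max 0 (4 - 2 * r)) *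 Literature.MathematicalPhysics.StatisticalMechanics.lennardJones r)) + κ * (Nat.card {i : Fin N // ¬ Literature.Geometry.DiscreteGeometry.IsChargeFree (1 / 100 : ℝ) y i ∧ i ∈ S} : ℝ) ≤ Literature.MathematicalPhysics.StatisticalMechanics.interactionEnergy (fun r => min 1 (max 0 (4 - 2 * r)) * Literature.MathematicalPhysics.StatisticalMechanics.lennardJones r) y + C * ((Finset.univ \ S).card : ℝ)) := by
  rintro ⟨κ, C, ρ, hκ, Φ, hΦ1, hΦ2, hΦ3⟩
  refine ⟨κ, (κ + 37 + max C 0) * (400 * max ρ 0 / 93 + 1) ^ 3 + max C 0 + 205, hκ,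
    fun N y hy S hS => ?_⟩
  exact near_pricing_assembly y hy _ _ S hS
    (fun i hi => by
      obtain ⟨s, F, g, -, -, hs, -, -⟩ := hi
      refine ⟨977 / 1000, by norm_num, fun j k hjk hj => ?_⟩
      have h := hs j k hjk (by linarith)
      linarith)
    _ κ C ρ iInf_energyPerParticle_truncLJ_nonpos hκ.le (Φ N y) (hΦ1 N y hy)
    (fun i => hΦ2 N y i hy) (fun i hi => hΦ3 N y i hy hi)

/-- **NEAR₂ ⇐ NEAR₂′** (bookkeeping of the line `elastic-basin-split`).  The `Finset` form of the charged
near₂-site pricing gives the subtype form with allowance `max C 0` per far₂ site: instantiate `S` with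
the filter of the near₂ predicate, so that `{charged ∧ i ∈ S} ≃ {charged ∧ near₂}` and
`#(univ \ S) = #far₂`. [folklore] -/
theorem ebs_nearChargePricing_of_finsetForm : (∃ κ C : ℝ, 0 < κ ∧ ∀ (N : ℕ) (y : Fin N → EuclideanSpace ℝ (Fin 3)), Function.Injective y → ∀ S : Finset (Fin N), (∀ i : Fin N, i ∈ S ↔ ∃ (s : ℤ → ℤ) (F : EuclideanSpace ℝ (Fin 3) →L[ℝ] EuclideanSpace ℝ (Fin 3)) (g : EuclideanSpace ℝ (Fin 3) ≃ᵃⁱ[ℝ] EuclideanSpace ℝ (Fin 3)), Literature.MathematicalPhysics.StatisticalMechanics.IsHaggSeq s ∧ (∀ v : EuclideanSpace ℝ (Fin 3), ‖F v - (977 / 1000 : ℝ) • v‖ ≤ 977 / 10000 * ‖v‖) ∧ (∀ j k : Fin N, j ≠ k → dist (y j) (y i) ≤ 2931 / 1000 → 977 / 2000 ≤ dist (y j) (y k)) ∧ (∀ j : Fin N, dist (y j) (y i) ≤ 2931 / 1000 → ∃ z ∈ Literature.MathematicalPhysics.StatisticalMechanics.barlowStacking 1 (Real.sqrt (2 / 3))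 s, dist (y j) (g (F z)) ≤ 977 / 8000) ∧ (∀ z ∈ Literature.MathematicalPhysics.StatisticalMechanics.barlowStacking 1 (Real.sqrt (2 / 3)) s, dist (g (F z)) (y i) ≤ 2931 / 1000 → ∃ j : Fin N, dist (y j) (g (F z)) ≤ 977 / 8000)) → (N : ℝ) * (⨅ Q : Literature.MathematicalPhysics.StatisticalMechanics.PeriodicConfiguration 3, Q.energyPerParticle (fun r => min 1 (max 0 (4 - 2 * r)) * Literature.MathematicalPhysics.StatisticalMechanics.lennardJones r)) + κ * (Nat.card {i : Fin N // ¬ Literature.Geometry.DiscreteGeometry.IsChargeFree (1 / 100 : ℝ) y i ∧ i ∈ S} : ℝ) ≤ Literature.MathematicalPhysics.StatisticalMechanics.interactionEnergy (fun r => min 1 (max 0 (4 - 2 * r)) * Literature.MathematicalPhysics.StatisticalMechanics.lennardJones r) y + C * ((Finset.univ \ S).card : ℝ)) → (∃ κ C : ℝ, 0 < κ ∧ ∀ (N : ℕ) (y : Fin N → EuclideanSpace ℝ (Fin 3)), Function.Injective y → (N : ℝ) * (⨅ Q : Literature.MathematicalPhysics.StatisticalMechanics.PeriodicConfiguration 3,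 Q.energyPerParticle (fun r => min 1 (max 0 (4 - 2 * r)) * Literature.MathematicalPhysics.StatisticalMechanics.lennardJones r)) + κ * (Nat.card {i : Fin N // ¬ Literature.Geometry.DiscreteGeometry.IsChargeFree (1 / 100 : ℝ) y i ∧ ∃ (s : ℤ → ℤ) (F : EuclideanSpace ℝ (Fin 3) →L[ℝ] EuclideanSpace ℝ (Fin 3)) (g : EuclideanSpace ℝ (Fin 3) ≃ᵃⁱ[ℝ] EuclideanSpace ℝ (Fin 3)), Literature.MathematicalPhysics.StatisticalMechanics.IsHaggSeq s ∧ (∀ v : EuclideanSpace ℝ (Fin 3), ‖F v - (977 / 1000 : ℝ) • v‖ ≤ 977 / 10000 * ‖v‖) ∧ (∀ j k : Fin N, j ≠ k → dist (y j) (y i) ≤ 2931 / 1000 → 977 / 2000 ≤ dist (y j) (y k)) ∧ (∀ j : Fin N, dist (y j) (y i) ≤ 2931 / 1000 → ∃ z ∈ Literature.MathematicalPhysics.StatisticalMechanics.barlowStacking 1 (Real.sqrt (2 / 3)) s, dist (y j) (g (F z)) ≤ 977 / 8000) ∧ (∀ z ∈ Literature.MathematicalPhysics.StatisticalMechanics.barlowStacking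 1 (Real.sqrt (2 / 3)) s, dist (g (F z)) (y i) ≤ 2931 / 1000 → ∃ j : Fin N, dist (y j) (g (F z)) ≤ 977 / 8000)} : ℝ) ≤ Literature.MathematicalPhysics.StatisticalMechanics.interactionEnergy (fun r => min 1 (max 0 (4 - 2 * r)) * Literature.MathematicalPhysics.StatisticalMechanics.lennardJones r) y + C * (Nat.card {i : Fin N // ¬ ∃ (s : ℤ → ℤ) (F : EuclideanSpace ℝ (Fin 3) →L[ℝ] EuclideanSpace ℝ (Fin 3)) (g : EuclideanSpace ℝ (Fin 3) ≃ᵃⁱ[ℝ] EuclideanSpace ℝ (Fin 3)), Literature.MathematicalPhysics.StatisticalMechanics.IsHaggSeq s ∧ (∀ v : EuclideanSpace ℝ (Fin 3), ‖F v - (977 / 1000 : ℝ) • v‖ ≤ 977 / 10000 * ‖v‖) ∧ (∀ j k : Fin N, j ≠ k → dist (y j) (y i) ≤ 2931 / 1000 → 977 / 2000 ≤ dist (y j) (y k)) ∧ (∀ j : Fin N, dist (y j) (y i) ≤ 2931 / 1000 → ∃ z ∈ Literature.MathematicalPhysics.StatisticalMechanics.barlowStacking 1 (Real.sqrt (2 /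 3)) s, dist (y j) (g (F z)) ≤ 977 / 8000) ∧ (∀ z ∈ Literature.MathematicalPhysics.StatisticalMechanics.barlowStacking 1 (Real.sqrt (2 / 3)) s, dist (g (F z)) (y i) ≤ 2931 / 1000 → ∃ j : Fin N, dist (y j) (g (F z)) ≤ 977 / 8000)} : ℝ)) := by
  rintro ⟨κ, C, hκ, h⟩
  refine ⟨κ, max C 0, hκ, fun N y hy => ?_⟩
  set S : Finset (Fin N) := Finset.univ.filter fun i => ∃ (s : ℤ → ℤ) (F : EuclideanSpace ℝ (Fin 3) →L[ℝ] EuclideanSpace ℝ (Fin 3)) (g : EuclideanSpace ℝ (Fin 3) ≃ᵃⁱ[ℝ] EuclideanSpace ℝ (Fin 3)), Literature.MathematicalPhysics.StatisticalMechanics.IsHaggSeq s ∧ (∀ v : EuclideanSpace ℝ (Fin 3), ‖F v - (977 / 1000 : ℝ) • v‖ ≤ 977 / 10000 * ‖v‖) ∧ (∀ j k : Fin N, j ≠ k → dist (y j) (y i) ≤ 2931 / 1000 → 977 / 2000 ≤ dist (y j) (y k)) ∧ (∀ j : Fin N, dist (y j) (y i) ≤ 2931 / 1000 → ∃ z ∈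 Literature.MathematicalPhysics.StatisticalMechanics.barlowStacking 1 (Real.sqrt (2 / 3)) s, dist (y j) (g (F z)) ≤ 977 / 8000) ∧ (∀ z ∈ Literature.MathematicalPhysics.StatisticalMechanics.barlowStacking 1 (Real.sqrt (2 / 3)) s, dist (g (F z)) (y i) ≤ 2931 / 1000 → ∃ j : Fin N, dist (y j) (g (F z)) ≤ 977 / 8000) with hS
  have hmem : ∀ i : Fin N, i ∈ S ↔ ∃ (s : ℤ → ℤ) (F : EuclideanSpace ℝ (Fin 3) →L[ℝ] EuclideanSpace ℝ (Fin 3)) (g : EuclideanSpace ℝ (Fin 3) ≃ᵃⁱ[ℝ] EuclideanSpace ℝ (Fin 3)), Literature.MathematicalPhysics.StatisticalMechanics.IsHaggSeq s ∧ (∀ v : EuclideanSpace ℝ (Fin 3), ‖F v - (977 / 1000 : ℝ) • v‖ ≤ 977 / 10000 * ‖v‖) ∧ (∀ j k : Fin N, j ≠ k → dist (y j) (y i) ≤ 2931 / 1000 → 977 / 2000 ≤ dist (y j) (y k)) ∧ (∀ j : Fin N, dist (y j) (y i) ≤ 2931 / 1000 → ∃ z ∈ Literature.MathematicalPhysics.StatisticalMechanics.barlowStacking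 1 (Real.sqrt (2 / 3)) s, dist (y j) (g (F z)) ≤ 977 / 8000) ∧ (∀ z ∈ Literature.MathematicalPhysics.StatisticalMechanics.barlowStacking 1 (Real.sqrt (2 / 3)) s, dist (g (F z)) (y i) ≤ 2931 / 1000 → ∃ j : Fin N, dist (y j) (g (F z)) ≤ 977 / 8000) := fun i => by
    rw [hS, Finset.mem_filter]; simp
  have h1 := h N y hy S hmem
  have e1 : (Nat.card {i : Fin N // ¬ Literature.Geometry.DiscreteGeometry.IsChargeFree (1 / 100 : ℝ) y i ∧ i ∈ S} : ℝ) =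
      (Nat.card {i : Fin N // ¬ Literature.Geometry.DiscreteGeometry.IsChargeFree (1 / 100 : ℝ) y i ∧ ∃ (s : ℤ → ℤ) (F : EuclideanSpace ℝ (Fin 3) →L[ℝ] EuclideanSpace ℝ (Fin 3)) (g : EuclideanSpace ℝ (Fin 3) ≃ᵃⁱ[ℝ] EuclideanSpace ℝ (Fin 3)), Literature.MathematicalPhysics.StatisticalMechanics.IsHaggSeq s ∧ (∀ v : EuclideanSpace ℝ (Fin 3), ‖F v - (977 / 1000 : ℝ) • v‖ ≤ 977 / 10000 * ‖v‖) ∧ (∀ j k : Fin N, j ≠ k → dist (y j) (y i) ≤ 2931 / 1000 → 977 / 2000 ≤ dist (y j) (y k)) ∧ (∀ j : Fin N, dist (y j) (y i) ≤ 2931 / 1000 → ∃ z ∈ Literature.MathematicalPhysics.StatisticalMechanics.barlowStacking 1 (Real.sqrt (2 / 3)) s, dist (y j) (g (F z)) ≤ 977 / 8000) ∧ (∀ z ∈ Literature.MathematicalPhysics.StatisticalMechanics.barlowStacking 1 (Real.sqrt (2 / 3)) s, dist (g (F z)) (y i) ≤ 2931 / 1000 → ∃ j : Fin N, dist (y j)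 (g (F z)) ≤ 977 / 8000)} : ℝ) := by
    congr 1
    exact Nat.card_congr (Equiv.subtypeEquivRight fun i => by rw [hmem])
  have e2 : ((Finset.univ \ S).card : ℝ) = (Nat.card {i : Fin N // ¬ ∃ (s : ℤ → ℤ) (F : EuclideanSpace ℝ (Fin 3) →L[ℝ] EuclideanSpace ℝ (Fin 3)) (g : EuclideanSpace ℝ (Fin 3) ≃ᵃⁱ[ℝ] EuclideanSpace ℝ (Fin 3)), Literature.MathematicalPhysics.StatisticalMechanics.IsHaggSeq s ∧ (∀ v : EuclideanSpace ℝ (Fin 3), ‖F v - (977 / 1000 : ℝ) • v‖ ≤ 977 / 10000 * ‖v‖) ∧ (∀ j k : Fin N, j ≠ k → dist (y j) (y i) ≤ 2931 / 1000 → 977 / 2000 ≤ dist (y j) (y k)) ∧ (∀ j : Fin N, dist (y j) (y i) ≤ 2931 / 1000 → ∃ z ∈ Literature.MathematicalPhysics.StatisticalMechanics.barlowStacking 1 (Real.sqrt (2 / 3)) s, dist (y j) (g (F z)) ≤ 977 / 8000) ∧ (∀ z ∈ Literature.MathematicalPhysics.StatisticalMechanics.barlowStacking 1 (Real.sqrt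 (2 / 3)) s, dist (g (F z)) (y i) ≤ 2931 / 1000 → ∃ j : Fin N, dist (y j) (g (F z)) ≤ 977 / 8000)} : ℝ) := by
    rw [Nat.card_eq_fintype_card, Fintype.card_subtype]
    congr 1
    congr 1
    ext i
    simp only [Finset.mem_sdiff, Finset.mem_univ, true_and, Finset.mem_filter]
    rw [hmem]
  rw [e1, e2] at h1
  have hc : C * (Nat.card {i : Fin N // ¬ ∃ (s : ℤ → ℤ) (F : EuclideanSpace ℝ (Fin 3) →L[ℝ] EuclideanSpace ℝ (Fin 3)) (g : EuclideanSpace ℝ (Fin 3) ≃ᵃⁱ[ℝ] EuclideanSpace ℝ (Fin 3)), Literature.MathematicalPhysics.StatisticalMechanics.IsHaggSeq s ∧ (∀ v : EuclideanSpace ℝ (Fin 3), ‖F v - (977 / 1000 : ℝ) • v‖ ≤ 977 / 10000 * ‖v‖) ∧ (∀ j k : Fin N, j ≠ k → dist (y j) (y i) ≤ 2931 / 1000 → 977 / 2000 ≤ dist (y j) (y k)) ∧ (∀ j : Fin N, dist (y j) (y i) ≤ 2931 / 1000 → ∃ z ∈ Literature.MathematicalPhysics.StatisticalMechanics.barlowStacking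 1 (Real.sqrt (2 / 3)) s, dist (y j) (g (F z)) ≤ 977 / 8000) ∧ (∀ z ∈ Literature.MathematicalPhysics.StatisticalMechanics.barlowStacking 1 (Real.sqrt (2 / 3)) s, dist (g (F z)) (y i) ≤ 2931 / 1000 → ∃ j : Fin N, dist (y j) (g (F z)) ≤ 977 / 8000)} : ℝ) ≤ max C 0 * (Nat.card {i : Fin N // ¬ ∃ (s : ℤ → ℤ) (F : EuclideanSpace ℝ (Fin 3) →L[ℝ] EuclideanSpace ℝ (Fin 3)) (g : EuclideanSpace ℝ (Fin 3) ≃ᵃⁱ[ℝ] EuclideanSpace ℝ (Fin 3)), Literature.MathematicalPhysics.StatisticalMechanics.IsHaggSeq s ∧ (∀ v : EuclideanSpace ℝ (Fin 3), ‖F v - (977 / 1000 : ℝ) • v‖ ≤ 977 / 10000 * ‖v‖) ∧ (∀ j k : Fin N, j ≠ k → dist (y j) (y i) ≤ 2931 / 1000 → 977 / 2000 ≤ dist (y j) (y k)) ∧ (∀ j : Fin N, dist (y j) (y i) ≤ 2931 / 1000 → ∃ z ∈ Literature.MathematicalPhysics.StatisticalMechanics.barlowStacking 1 (Real.sqrt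 (2 / 3)) s, dist (y j) (g (F z)) ≤ 977 / 8000) ∧ (∀ z ∈ Literature.MathematicalPhysics.StatisticalMechanics.barlowStacking 1 (Real.sqrt (2 / 3)) s, dist (g (F z)) (y i) ≤ 2931 / 1000 → ∃ j : Fin N, dist (y j) (g (F z)) ≤ 977 / 8000)} : ℝ) :=
    mul_le_mul_of_nonneg_right (le_max_left _ _) (Nat.cast_nonneg _)
  linarith

/-! ## The elastic-basin glue -/

/-- **crux ⇐ FAR₂ ∧ NEAR₂** (registered sub-goal `truncatedCensusGap_of_elasticBasinSplit`, the
composition of the line `elastic-basin-split`).  If every far₂ site (closed `3a₀`-patch NOT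
`a₀/2`-separated and two-way `a₀/8`-matched to an affinely strained, `10 %`, rigidly moved Barlow stacking)
pays `κ₂ > 0` above `N e_χ*`, and every charged near₂ site pays `κ₁ > 0` up to an allowance `C` per far₂
site, then `TruncatedCensusGap` holds with `κ := κ₁κ₂/(κ₁ + κ₂ + max C 0)`: a charged site is
charged-and-near₂ or far₂, `#charged ≤ #(charged ∧ near₂) + #far₂`, and
`κ₁κ₂ #charged ≤ κ₂ (E − N e* + max C 0 · #far₂) + κ₁ (E − N e*) ≤ (κ₁ + κ₂ + max C 0)(E − N e*)`.
[folklore] -/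
theorem truncatedCensusGap_of_elasticBasinSplit : (∃ κ : ℝ, 0 < κ ∧ ∀ (N : ℕ) (y : Fin N → EuclideanSpace ℝ (Fin 3)), Function.Injective y → (N : ℝ) * (⨅ Q : Literature.MathematicalPhysics.StatisticalMechanics.PeriodicConfiguration 3, Q.energyPerParticle (fun r => min 1 (max 0 (4 - 2 * r)) * Literature.MathematicalPhysics.StatisticalMechanics.lennardJones r)) + κ * (Nat.card {i : Fin N // ¬ ∃ (s : ℤ → ℤ) (F : EuclideanSpace ℝ (Fin 3) →L[ℝ] EuclideanSpace ℝ (Fin 3)) (g : EuclideanSpace ℝ (Fin 3) ≃ᵃⁱ[ℝ] EuclideanSpace ℝ (Fin 3)), Literature.MathematicalPhysics.StatisticalMechanics.IsHaggSeq s ∧ (∀ v : EuclideanSpace ℝ (Fin 3), ‖F v - (977 / 1000 : ℝ) • v‖ ≤ 977 / 10000 * ‖v‖) ∧ (∀ j k : Fin N, j ≠ k → dist (y j) (y i) ≤ 2931 / 1000 → 977 / 2000 ≤ dist (y j) (y k)) ∧ (∀ j : Fin N, dist (y j) (y i) ≤ 2931 / 1000 → ∃ z ∈ Literature.MathematicalPhysics.StatisticalMechanics.barlowStacking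 1 (Real.sqrt (2 / 3)) s, dist (y j) (g (F z)) ≤ 977 / 8000) ∧ (∀ z ∈ Literature.MathematicalPhysics.StatisticalMechanics.barlowStacking 1 (Real.sqrt (2 / 3)) s, dist (g (F z)) (y i) ≤ 2931 / 1000 → ∃ j : Fin N, dist (y j) (g (F z)) ≤ 977 / 8000)} : ℝ) ≤ Literature.MathematicalPhysics.StatisticalMechanics.interactionEnergy (fun r => min 1 (max 0 (4 - 2 * r)) * Literature.MathematicalPhysics.StatisticalMechanics.lennardJones r) y) → (∃ κ C : ℝ, 0 < κ ∧ ∀ (N : ℕ) (y : Fin N → EuclideanSpace ℝ (Fin 3)), Function.Injective y → (N : ℝ) * (⨅ Q : Literature.MathematicalPhysics.StatisticalMechanics.PeriodicConfiguration 3, Q.energyPerParticle (fun r => min 1 (max 0 (4 - 2 * r)) * Literature.MathematicalPhysics.StatisticalMechanics.lennardJones r)) + κ * (Nat.card {i : Fin N // ¬ Literature.Geometry.DiscreteGeometry.IsChargeFree (1 / 100 : ℝ) y i ∧ ∃ (s : ℤ → ℤ) (F : EuclideanSpace ℝ (Fin 3) →L[ℝ] EuclideanSpace ℝ (Fin 3))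 (g : EuclideanSpace ℝ (Fin 3) ≃ᵃⁱ[ℝ] EuclideanSpace ℝ (Fin 3)), Literature.MathematicalPhysics.StatisticalMechanics.IsHaggSeq s ∧ (∀ v : EuclideanSpace ℝ (Fin 3), ‖F v - (977 / 1000 : ℝ) • v‖ ≤ 977 / 10000 * ‖v‖) ∧ (∀ j k : Fin N, j ≠ k → dist (y j) (y i) ≤ 2931 / 1000 → 977 / 2000 ≤ dist (y j) (y k)) ∧ (∀ j : Fin N, dist (y j) (y i) ≤ 2931 / 1000 → ∃ z ∈ Literature.MathematicalPhysics.StatisticalMechanics.barlowStacking 1 (Real.sqrt (2 / 3)) s, dist (y j) (g (F z)) ≤ 977 / 8000) ∧ (∀ z ∈ Literature.MathematicalPhysics.StatisticalMechanics.barlowStacking 1 (Real.sqrt (2 / 3)) s, dist (g (F z)) (y i) ≤ 2931 / 1000 → ∃ j : Fin N, dist (y j) (g (F z)) ≤ 977 / 8000)} : ℝ) ≤ Literature.MathematicalPhysics.StatisticalMechanics.interactionEnergy (fun r => min 1 (max 0 (4 - 2 * r)) * Literature.MathematicalPhysics.StatisticalMechanics.lennardJones r) y + C * (Nat.card {i :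 Fin N // ¬ ∃ (s : ℤ → ℤ) (F : EuclideanSpace ℝ (Fin 3) →L[ℝ] EuclideanSpace ℝ (Fin 3)) (g : EuclideanSpace ℝ (Fin 3) ≃ᵃⁱ[ℝ] EuclideanSpace ℝ (Fin 3)), Literature.MathematicalPhysics.StatisticalMechanics.IsHaggSeq s ∧ (∀ v : EuclideanSpace ℝ (Fin 3), ‖F v - (977 / 1000 : ℝ) • v‖ ≤ 977 / 10000 * ‖v‖) ∧ (∀ j k : Fin N, j ≠ k → dist (y j) (y i) ≤ 2931 / 1000 → 977 / 2000 ≤ dist (y j) (y k)) ∧ (∀ j : Fin N, dist (y j) (y i) ≤ 2931 / 1000 → ∃ z ∈ Literature.MathematicalPhysics.StatisticalMechanics.barlowStacking 1 (Real.sqrt (2 / 3)) s, dist (y j) (g (F z)) ≤ 977 / 8000) ∧ (∀ z ∈ Literature.MathematicalPhysics.StatisticalMechanics.barlowStacking 1 (Real.sqrt (2 / 3)) s, dist (g (F z)) (y i) ≤ 2931 / 1000 → ∃ j : Fin N, dist (y j) (g (F z)) ≤ 977 / 8000)} : ℝ)) → Summit.AtomisticToContinuum.Crystallization.Theses.PricedLinkCensus.TruncatedCensusGap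 := by
  intro hFar' hNear'
  obtain ⟨κ₂, hκ₂, hFar⟩ := hFar'
  obtain ⟨κ₁, C, hκ₁, hNear⟩ := hNear'
  -- the price
  set C' : ℝ := max C 0 with hC'
  have hC'0 : 0 ≤ C' := le_max_right _ _
  have hCC' : C ≤ C' := le_max_left _ _
  have hS : 0 < κ₁ + κ₂ + C' := by linarith
  refine ⟨κ₁ * κ₂ / (κ₁ + κ₂ + C'), div_pos (mul_pos hκ₁ hκ₂) hS, fun N y hy => ?_⟩
  have e1 := hFar N y hy
  have e2 := hNear N y hy
  -- abbreviations
  set E : ℝ := Literature.MathematicalPhysics.StatisticalMechanics.interactionEnergy (fun r => min 1 (max 0 (4 - 2 * r)) * Literature.MathematicalPhysics.StatisticalMechanics.lennardJones r) y with hE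
  set estar : ℝ := (⨅ Q : Literature.MathematicalPhysics.StatisticalMechanics.PeriodicConfiguration 3, Q.energyPerParticle (fun r => min 1 (max 0 (4 - 2 * r)) * Literature.MathematicalPhysics.StatisticalMechanics.lennardJones r)) with hestar
  set near : Fin N → Prop := fun i => ∃ (s : ℤ → ℤ) (F : EuclideanSpace ℝ (Fin 3) →L[ℝ] EuclideanSpace ℝ (Fin 3)) (g : EuclideanSpace ℝ (Fin 3) ≃ᵃⁱ[ℝ] EuclideanSpace ℝ (Fin 3)), Literature.MathematicalPhysics.StatisticalMechanics.IsHaggSeq s ∧ (∀ v : EuclideanSpace ℝ (Fin 3), ‖F v - (977 / 1000 : ℝ) • v‖ ≤ 977 / 10000 * ‖v‖) ∧ (∀ j k : Fin N, j ≠ k → dist (y j) (y i) ≤ 2931 / 1000 → 977 / 2000 ≤ dist (y j) (y k)) ∧ (∀ j : Fin N, dist (y j) (y i) ≤ 2931 / 1000 → ∃ z ∈ Literature.MathematicalPhysics.StatisticalMechanics.barlowStacking 1 (Real.sqrt (2 / 3)) s, dist (y j) (g (F z)) ≤ 977 / 8000) ∧ (∀ z ∈ Literature.MathematicalPhysics.StatisticalMechanics.barlowStacking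 1 (Real.sqrt (2 / 3)) s, dist (g (F z)) (y i) ≤ 2931 / 1000 → ∃ j : Fin N, dist (y j) (g (F z)) ≤ 977 / 8000) with hnear
  -- the three finsets
  set Ch := Finset.univ.filter fun i : Fin N => ¬ IsChargeFree (1 / 100 : ℝ) y i with hCh
  set Fr := Finset.univ.filter fun i : Fin N => ¬ near i with hFr
  set Nc := Finset.univ.filter fun i : Fin N => ¬ IsChargeFree (1 / 100 : ℝ) y i ∧ near i with hNc
  have hChNat : (Nat.card {i : Fin N // ¬ IsChargeFree (1 / 100 : ℝ) y i} : ℝ) = Ch.card := by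
    rw [Nat.card_eq_fintype_card, Fintype.card_subtype]
  have hFrNat : (Nat.card {i : Fin N // ¬ near i} : ℝ) = Fr.card := by
    rw [Nat.card_eq_fintype_card, Fintype.card_subtype]
  have hNcNat : (Nat.card {i : Fin N // ¬ IsChargeFree (1 / 100 : ℝ) y i ∧ near i} : ℝ) = Nc.card := by
    rw [Nat.card_eq_fintype_card, Fintype.card_subtype]
  -- (1) a charged site is charged-and-near₂ or far₂
  have hcover : Ch ⊆ Nc ∪ Fr := by
    intro i hi
    have hci : ¬ IsChargeFree (1 / 100 : ℝ) y i := (Finset.mem_filter.1 hi).2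
    by_cases hn : near i
    · exact Finset.mem_union_left _ (Finset.mem_filter.2 ⟨Finset.mem_univ _, hci, hn⟩)
    · exact Finset.mem_union_right _ (Finset.mem_filter.2 ⟨Finset.mem_univ _, hn⟩)
  have hcard : (Ch.card : ℝ) ≤ Nc.card + Fr.card := by
    exact_mod_cast (Finset.card_le_card hcover).trans (Finset.card_union_le Nc Fr)
  -- (2) the two hypotheses in finset form
  change (N : ℝ) * estar + κ₂ * (Nat.card {i : Fin N // ¬ near i} : ℝ) ≤ E at e1
  change (N : ℝ) * estar + κ₁ * (Nat.card {i : Fin N // ¬ IsChargeFree (1 / 100 : ℝ) y i ∧ near i} : ℝ)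
      ≤ E + C * (Nat.card {i : Fin N // ¬ near i} : ℝ) at e2
  rw [hFrNat] at e1
  rw [hNcNat, hFrNat] at e2
  change (N : ℝ) * estar + κ₁ * κ₂ / (κ₁ + κ₂ + C') *
      (Nat.card {i : Fin N // ¬ IsChargeFree (1 / 100 : ℝ) y i} : ℝ) ≤ E
  rw [hChNat]
  have hF0 : (0 : ℝ) ≤ Fr.card := Nat.cast_nonneg _
  have hX1 : κ₂ * (Fr.card : ℝ) ≤ E - N * estar := by linarith
  have hX2 : κ₁ * (Nc.card : ℝ) ≤ (E - N * estar) + C' * Fr.card := by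
    have : C * (Fr.card : ℝ) ≤ C' * Fr.card := mul_le_mul_of_nonneg_right hCC' hF0
    linarith
  have key : κ₁ * κ₂ * (Ch.card : ℝ) ≤ (κ₁ + κ₂ + C') * (E - N * estar) := by
    have a1 : κ₁ * κ₂ * (Ch.card : ℝ) ≤ κ₁ * κ₂ * (Nc.card + Fr.card) :=
      mul_le_mul_of_nonneg_left hcard (mul_pos hκ₁ hκ₂).le
    have a2 : κ₂ * (κ₁ * (Nc.card : ℝ)) ≤ κ₂ * ((E - N * estar) + C' * Fr.card) :=
      mul_le_mul_of_nonneg_left hX2 hκ₂.le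
    have a3 : κ₁ * (κ₂ * (Fr.card : ℝ)) ≤ κ₁ * (E - N * estar) :=
      mul_le_mul_of_nonneg_left hX1 hκ₁.le
    have a4 : C' * (κ₂ * (Fr.card : ℝ)) ≤ C' * (E - N * estar) :=
      mul_le_mul_of_nonneg_left hX1 hC'0
    nlinarith
  have hfin : κ₁ * κ₂ / (κ₁ + κ₂ + C') * (Ch.card : ℝ) ≤ E - N * estar := by
    rw [div_mul_eq_mul_div, div_le_iff₀ hS]
    linarith
  linarith

/-- **crux ⇐ FAR₂ ∧ LNP₂** (registered sub-goal `truncatedCensusGap_of_defectFar_of_localNearPricing2`: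
THE CRUX MODULO ITS TWO OPEN CORES at the elastic-basin cut).  `TruncatedCensusGap` follows from the
defect far-site gap FAR₂ and the local near₂ pricing LNP₂; the bookkeeping in between
(`ebs_nearChargePricingF_of_localNearPricing2`, `ebs_nearChargePricing_of_finsetForm`,
`truncatedCensusGap_of_elasticBasinSplit`) is proved. [folklore] -/
theorem truncatedCensusGap_of_defectFar_of_localNearPricing2 : (∃ κ : ℝ, 0 < κ ∧ ∀ (N : ℕ) (y : Fin N → EuclideanSpace ℝ (Fin 3)), Function.Injective y → (N : ℝ) * (⨅ Q : Literature.MathematicalPhysics.StatisticalMechanics.PeriodicConfiguration 3, Q.energyPerParticle (fun r => min 1 (max 0 (4 - 2 * r)) * Literature.MathematicalPhysics.StatisticalMechanics.lennardJones r)) + κ * (Nat.card {i : Fin N // ¬ ∃ (s : ℤ → ℤ) (F : EuclideanSpace ℝ (Fin 3) →L[ℝ] EuclideanSpace ℝ (Fin 3)) (g : EuclideanSpace ℝ (Fin 3) ≃ᵃⁱ[ℝ] EuclideanSpace ℝ (Fin 3)), Literature.MathematicalPhysics.StatisticalMechanics.IsHaggSeq s ∧ (∀ v : EuclideanSpace ℝ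 (Fin 3), ‖F v - (977 / 1000 : ℝ) • v‖ ≤ 977 / 10000 * ‖v‖) ∧ (∀ j k : Fin N, j ≠ k → dist (y j) (y i) ≤ 2931 / 1000 → 977 / 2000 ≤ dist (y j) (y k)) ∧ (∀ j : Fin N, dist (y j) (y i) ≤ 2931 / 1000 → ∃ z ∈ Literature.MathematicalPhysics.StatisticalMechanics.barlowStacking 1 (Real.sqrt (2 / 3)) s, dist (y j) (g (F z)) ≤ 977 / 8000) ∧ (∀ z ∈ Literature.MathematicalPhysics.StatisticalMechanics.barlowStacking 1 (Real.sqrt (2 / 3)) s, dist (g (F z)) (y i) ≤ 2931 / 1000 → ∃ j : Fin N, dist (y j) (g (F z)) ≤ 977 / 8000)} : ℝ) ≤ Literature.MathematicalPhysics.StatisticalMechanics.interactionEnergy (fun r => min 1 (max 0 (4 - 2 * r)) * Literature.MathematicalPhysics.StatisticalMechanics.lennardJones r) y) → (∃ κ C ρ : ℝ, 0 < κ ∧ ∃ Φ : (N : ℕ) → (Fin N → EuclideanSpace ℝ (Fin 3)) → Fin N → ℝ, (∀ (N : ℕ) (y : Fin N → EuclideanSpace ℝ (Fin 3)), Function.Injective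 y → ∑ i, Φ N y i = 0) ∧ (∀ (N : ℕ) (y : Fin N → EuclideanSpace ℝ (Fin 3)) (i : Fin N), Function.Injective y → |Φ N y i| ≤ C) ∧ ∀ (N : ℕ) (y : Fin N → EuclideanSpace ℝ (Fin 3)) (i : Fin N), Function.Injective y → (∀ i' : Fin N, dist (y i') (y i) ≤ ρ → ∃ (s : ℤ → ℤ) (F : EuclideanSpace ℝ (Fin 3) →L[ℝ] EuclideanSpace ℝ (Fin 3)) (g : EuclideanSpace ℝ (Fin 3) ≃ᵃⁱ[ℝ] EuclideanSpace ℝ (Fin 3)), Literature.MathematicalPhysics.StatisticalMechanics.IsHaggSeq s ∧ (∀ v : EuclideanSpace ℝ (Fin 3), ‖F v - (977 / 1000 : ℝ) • v‖ ≤ 977 / 10000 * ‖v‖) ∧ (∀ j k : Fin N, j ≠ k → dist (y j) (y i') ≤ 2931 / 1000 → 977 / 2000 ≤ dist (y j) (y k)) ∧ (∀ j : Fin N, dist (y j) (y i') ≤ 2931 / 1000 → ∃ z ∈ Literature.MathematicalPhysics.StatisticalMechanics.barlowStacking 1 (Real.sqrt (2 / 3)) s, dist (y j) (g (F z)) ≤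 977 / 8000) ∧ (∀ z ∈ Literature.MathematicalPhysics.StatisticalMechanics.barlowStacking 1 (Real.sqrt (2 / 3)) s, dist (g (F z)) (y i') ≤ 2931 / 1000 → ∃ j : Fin N, dist (y j) (g (F z)) ≤ 977 / 8000)) → (⨅ Q : Literature.MathematicalPhysics.StatisticalMechanics.PeriodicConfiguration 3, Q.energyPerParticle (fun r => min 1 (max 0 (4 - 2 * r)) * Literature.MathematicalPhysics.StatisticalMechanics.lennardJones r)) ≤ Literature.MathematicalPhysics.StatisticalMechanics.siteEnergy (fun r => min 1 (max 0 (4 - 2 * r)) * Literature.MathematicalPhysics.StatisticalMechanics.lennardJones r) y i / 2 + Φ N y i ∧ (¬ Literature.Geometry.DiscreteGeometry.IsChargeFree (1 / 100 : ℝ) y i → (⨅ Q : Literature.MathematicalPhysics.StatisticalMechanics.PeriodicConfiguration 3, Q.energyPerParticle (fun r => min 1 (max 0 (4 - 2 * r)) * Literature.MathematicalPhysics.StatisticalMechanics.lennardJones r)) + κ ≤ Literature.MathematicalPhysics.StatisticalMechanics.siteEnergy (fun r => min 1 (max 0 (4 - 2 * r)) * Literature.MathematicalPhysics.StatisticalMechanics.lennardJones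 r) y i / 2 + Φ N y i)) → Summit.AtomisticToContinuum.Crystallization.Theses.PricedLinkCensus.TruncatedCensusGap :=
  fun hFar hLNP => truncatedCensusGap_of_elasticBasinSplit hFar
    (ebs_nearChargePricing_of_finsetForm (ebs_nearChargePricingF_of_localNearPricing2 hLNP))

/-! ## Calibration: NEAR₂ is a genuine piece of the crux -/

/-- **NEAR₂ ⇐ crux** (registered sub-goal `nearChargePricing_of_truncatedCensusGap`, calibration of the
line `elastic-basin-split`).  `TruncatedCensusGap` implies the charged near₂-site pricing with the same
`κ` and allowance `C = 0`: a charged-and-near₂ site is charged (`Subtype.impEmbedding`). [folklore] -/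
theorem nearChargePricing_of_truncatedCensusGap : Summit.AtomisticToContinuum.Crystallization.Theses.PricedLinkCensus.TruncatedCensusGap → (∃ κ C : ℝ, 0 < κ ∧ ∀ (N : ℕ) (y : Fin N → EuclideanSpace ℝ (Fin 3)), Function.Injective y → (N : ℝ) * (⨅ Q : Literature.MathematicalPhysics.StatisticalMechanics.PeriodicConfiguration 3, Q.energyPerParticle (fun r => min 1 (max 0 (4 - 2 * r)) * Literature.MathematicalPhysics.StatisticalMechanics.lennardJones r)) + κ * (Nat.card {i : Fin N // ¬ Literature.Geometry.DiscreteGeometry.IsChargeFree (1 / 100 : ℝ) y i ∧ ∃ (s : ℤ → ℤ) (F : EuclideanSpace ℝ (Fin 3) →L[ℝ] EuclideanSpace ℝ (Fin 3)) (g : EuclideanSpace ℝ (Fin 3) ≃ᵃⁱ[ℝ] EuclideanSpace ℝ (Fin 3)), Literature.MathematicalPhysics.StatisticalMechanics.IsHaggSeq s ∧ (∀ v : EuclideanSpace ℝ (Fin 3), ‖F v - (977 / 1000 : ℝ) • v‖ ≤ 977 / 10000 * ‖v‖) ∧ (∀ j k : Fin N, j ≠ k → dist (y j) (y i) ≤ 2931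 / 1000 → 977 / 2000 ≤ dist (y j) (y k)) ∧ (∀ j : Fin N, dist (y j) (y i) ≤ 2931 / 1000 → ∃ z ∈ Literature.MathematicalPhysics.StatisticalMechanics.barlowStacking 1 (Real.sqrt (2 / 3)) s, dist (y j) (g (F z)) ≤ 977 / 8000) ∧ (∀ z ∈ Literature.MathematicalPhysics.StatisticalMechanics.barlowStacking 1 (Real.sqrt (2 / 3)) s, dist (g (F z)) (y i) ≤ 2931 / 1000 → ∃ j : Fin N, dist (y j) (g (F z)) ≤ 977 / 8000)} : ℝ) ≤ Literature.MathematicalPhysics.StatisticalMechanics.interactionEnergy (fun r => min 1 (max 0 (4 - 2 * r)) * Literature.MathematicalPhysics.StatisticalMechanics.lennardJones r) y + C * (Nat.card {i : Fin N // ¬ ∃ (s : ℤ → ℤ) (F : EuclideanSpace ℝ (Fin 3) →L[ℝ] EuclideanSpace ℝ (Fin 3)) (g : EuclideanSpace ℝ (Fin 3) ≃ᵃⁱ[ℝ] EuclideanSpace ℝ (Fin 3)), Literature.MathematicalPhysics.StatisticalMechanics.IsHaggSeq s ∧ (∀ v : EuclideanSpace ℝ (Fin 3), ‖F v - (977 /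 1000 : ℝ) • v‖ ≤ 977 / 10000 * ‖v‖) ∧ (∀ j k : Fin N, j ≠ k → dist (y j) (y i) ≤ 2931 / 1000 → 977 / 2000 ≤ dist (y j) (y k)) ∧ (∀ j : Fin N, dist (y j) (y i) ≤ 2931 / 1000 → ∃ z ∈ Literature.MathematicalPhysics.StatisticalMechanics.barlowStacking 1 (Real.sqrt (2 / 3)) s, dist (y j) (g (F z)) ≤ 977 / 8000) ∧ (∀ z ∈ Literature.MathematicalPhysics.StatisticalMechanics.barlowStacking 1 (Real.sqrt (2 / 3)) s, dist (g (F z)) (y i) ≤ 2931 / 1000 → ∃ j : Fin N, dist (y j) (g (F z)) ≤ 977 / 8000)} : ℝ)) := by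
  intro h
  obtain ⟨κ, hκ, h⟩ := h
  refine ⟨κ, 0, hκ, fun N y hy => ?_⟩
  have h1 := h N y hy
  rw [zero_mul, add_zero]
  refine le_trans ?_ h1
  have hle := Nat.card_le_card_of_injective _
    (Subtype.impEmbedding
      (fun i : Fin N => ¬ Literature.Geometry.DiscreteGeometry.IsChargeFree (1 / 100 : ℝ) y i ∧ ∃ (s : ℤ → ℤ) (F : EuclideanSpace ℝ (Fin 3) →L[ℝ] EuclideanSpace ℝ (Fin 3)) (g : EuclideanSpace ℝ (Fin 3) ≃ᵃⁱ[ℝ] EuclideanSpace ℝ (Fin 3)), Literature.MathematicalPhysics.StatisticalMechanics.IsHaggSeq s ∧ (∀ v : EuclideanSpace ℝ (Fin 3), ‖F v - (977 / 1000 : ℝ) • v‖ ≤ 977 / 10000 * ‖v‖) ∧ (∀ j k : Fin N, j ≠ k → dist (y j) (y i) ≤ 2931 / 1000 → 977 / 2000 ≤ dist (y j) (y k)) ∧ (∀ j : Fin N, dist (y j) (y i) ≤ 2931 / 1000 → ∃ z ∈ Literature.MathematicalPhysics.StatisticalMechanics.barlowStacking 1 (Real.sqrt (2 / 3)) s, dist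 (y j) (g (F z)) ≤ 977 / 8000) ∧ (∀ z ∈ Literature.MathematicalPhysics.StatisticalMechanics.barlowStacking 1 (Real.sqrt (2 / 3)) s, dist (g (F z)) (y i) ≤ 2931 / 1000 → ∃ j : Fin N, dist (y j) (g (F z)) ≤ 977 / 8000))
      (fun i : Fin N => ¬ Literature.Geometry.DiscreteGeometry.IsChargeFree (1 / 100 : ℝ) y i) fun i hi => hi.1).injective
  have hcast := (Nat.cast_le (α := ℝ)).mpr hle
  have hle' := mul_le_mul_of_nonneg_left hcast hκ.le
  linarith

end Summit.AtomisticToContinuum.Crystallization.Theorems.PricedLinkCensusTruncatedCensusGap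

end
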